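import Literature.GroupTheory.FiniteAbelian.HomCounts
import Mathlib.Algebra.Module.Torsion.Basic
import Mathlib.RingTheory.LocalRing.MaximalIdeal.Basic
import Mathlib.RingTheory.Ideal.Quotient.Basic
import HarnessLib

/-!
# Reading a balanced `ℤ/p`-valued pairing through a residue-field functional: the `R/𝔪`-valued `R`-bilinear
# pairing with the same kernels (Frobenius duality of a finite field over `𝔽_p`) — proofs file

Topic `Algebra/Module`. THEOREMS ONLY: no definition, no named fact, no instance, no notation, no `sorry`.
Cell `pub/bsd-print-x9` (seat x10b-p1-w7 g12, brick «C451-VALUES», `--supports stmt-BirchSwinnertonDyer-22642`): the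
VALUES step between a kernel port of Howard 2004 Prop. 1.4.1 / Flach in the tree's local-duality currency — readings
`λ : R →+ ℤ/p^k` of `R`-valued cup products (`Howard2004/DualityDatumLocalCupScalarReadingProofs`, `localTatePairingZMod`;
Morgan–Smith arXiv:2103.08530 §3: `ℚ/ℤ`-valued, `ℤ`-bilinear, `R`-balanced by naturality) — and the typed print leaf
`Howard2004.prop141_casselsTate_skewPairing_atLevel` / its tower entry (`CasselsTateSkewPairingOfTowerPairing[Linear]Proofs`),
which want an `R/𝔪`-valued `R`-BILINEAR pairing with the SAME kernels («pairing of `R/𝔪`-vector spaces … → R[𝔪]»,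
Howard p. 1449).  When `[R/𝔪 : 𝔽_p] > 1` this is the trace/Frobenius step; when `R/𝔪 = 𝔽_p` it is the identity.

STATEMENTS (`R` a local commutative ring with FINITE residue ring `k = R/𝔪` of characteristic `p`, i.e. `p ∈ 𝔪`;
`ι : k →+ ℤ/p` ANY non-zero additive functional — e.g. a trace, or the residue of the port's reading `λ`).
* §1 **`injective_reading_mulLeft`**, `natCard_addMonoidHom_residue_zmod`, **`bijective_reading_mulLeft`**, `exists_reading_ne_zero`: `c ↦ ι(c ·)` is a bijection
  `k ≃ Hom(k, ℤ/p)` — injective because a non-zero `c` is a unit of `k` (`R` local) and `ι ≠ 0`; onto by counting,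
  `|Hom(k, ℤ/p)| = |k[p]| = |k|` (`FiniteAbelian.natCard_addMonoidHom_zmod_right`).  (Frobenius: `k` is self-dual over `𝔽_p`.)
* §2 **`exists_bilinear_of_balanced_zmod_pairing`**: for `R`-modules `A`, `B` with `𝔪B = 0` and a bi-additive
  `R`-BALANCED pairing `Q : A × B → ℤ/p` (`Q(ra, b) = Q(a, rb)`), there is an `R`-bilinear
  `P : A →ₗ[R] B →ₗ[R] k` READ BY `ι` — `ι(r̄ · P(a,b)) = Q(ra, b)` for all `r`, in particular `ι ∘ P = Q` — with
  the SAME LEFT AND RIGHT KERNELS as `Q`, UNIQUE among `R`-bilinear `k`-valued pairings read by `ι`, and along which every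
  skew identity `Q(a, f a') = -Q(a', f a)` (`f : A →ₗ[R] B`) transports to `P(a, f a') = -P(a', f a)`.
  (Construction: `P(a, b)` is the unique `c` with `ι(c x) = Q(a, x • b)` for all `x ∈ k`, `B` being a `k`-module.)

References: standard linear algebra (the additive dual of a finite field over its prime field is free of rank one over the
field: e.g. [SerreLocalFields1979] III §3 (trace form), [Hungerford1974] Ch. IV §4); the application is
[Howard2004HeegnerKolyvagin] Thm. 1.4.2 proof, display (i) (arXiv:1202.6340 p0008 L116–L128).  HONEST FRAMING: pure algebra;
nothing about Galois cohomology is proved here; no summit statement is proved; BSD is not proved by any of this.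
-/

set_option autoImplicit false

namespace Literature.Algebra.Module

open Function

/-! ## §1 The reading bijection `k ≃ Hom(k, ℤ/p)`, `c ↦ ι(c ·)` -/

section Reading

variable {R : Type*} [CommRing R] [IsLocalRing R] {p : ℕ} [Fact p.Prime]

omit [Fact p.Prime] in
/-- **`c ↦ ι(c ·)` is injective** for a non-zero additive `ι : R/𝔪 →+ ℤ/p` (`R` local): if `ι((c - c') x) = 0` for all
`x` and `c ≠ c'`, then `c - c'` lifts to a unit of `R`, so `ι = 0`. [folklore] [cite: Hungerford1974, Ch. IV §4 (duals of finite abelian groups), with the unit criterion of a local ring] -/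
theorem injective_reading_mulLeft (ι : (R ⧸ IsLocalRing.maximalIdeal R) →+ ZMod p) (hι : ι ≠ 0) :
    Function.Injective (fun c : R ⧸ IsLocalRing.maximalIdeal R => ι.comp (AddMonoidHom.mulLeft c)) := by
  intro c c' h
  by_contra hne
  apply hι
  have key : ∀ x, ι ((c - c') * x) = 0 := fun x => by
    have h1 := DFunLike.congr_fun h x
    simp only [AddMonoidHom.comp_apply, AddMonoidHom.coe_mulLeft] at h1
    rw [sub_mul, map_sub, sub_eq_zero]
    exact h1
  -- `c - c'` is a unit of `R/𝔪`
  obtain ⟨r, hr⟩ := Ideal.Quotient.mk_surjective (c - c')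
  have hr0 : r ∉ IsLocalRing.maximalIdeal R := fun hm => by
    have : c - c' = 0 := by rw [← hr]; exact Ideal.Quotient.eq_zero_iff_mem.mpr hm
    exact hne (sub_eq_zero.mp this)
  have hu : IsUnit r := by
    by_contra hnu
    exact hr0 ((IsLocalRing.mem_maximalIdeal r).mpr hnu)
  obtain ⟨u, hu'⟩ := (hu.map (Ideal.Quotient.mk (IsLocalRing.maximalIdeal R)))
  rw [hr] at hu'
  ext y
  have h2 := key (↑u⁻¹ * y)
  rwa [← hu', ← mul_assoc, Units.mul_inv, one_mul] at h2

/-- **`|Hom(R/𝔪, ℤ/p)| = |R/𝔪|`** when the residue ring is finite of characteristic `p` (`p ∈ 𝔪`): every element is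
`p`-torsion, so `|Hom(k, ℤ/p)| = |k[p]| = |k|`. [folklore] [cite: Hungerford1974, Ch. IV §4 Exercise 1 (a) (|Hom(G, ℤ/n)| = |G[n]|)] -/
theorem natCard_addMonoidHom_residue_zmod [Finite (R ⧸ IsLocalRing.maximalIdeal R)]
    (hp : (p : R) ∈ IsLocalRing.maximalIdeal R) :
    Nat.card ((R ⧸ IsLocalRing.maximalIdeal R) →+ ZMod p) = Nat.card (R ⧸ IsLocalRing.maximalIdeal R) := by
  haveI : NeZero p := ⟨(Fact.out : p.Prime).ne_zero⟩
  rw [Literature.GroupTheory.FiniteAbelian.natCard_addMonoidHom_zmod_right]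
  have htop : AddSubgroup.torsionBy (R ⧸ IsLocalRing.maximalIdeal R) p = ⊤ := by
    rw [eq_top_iff]
    intro x _
    refine AddSubgroup.torsionBy.nsmul_iff.mpr ?_
    obtain ⟨r, rfl⟩ := Ideal.Quotient.mk_surjective x
    rw [← map_nsmul, nsmul_eq_mul, Ideal.Quotient.eq_zero_iff_mem]
    exact Ideal.mul_mem_right _ _ hp
  rw [htop, AddSubgroup.card_top]

/-- **`c ↦ ι(c ·)` is a BIJECTION `R/𝔪 ≃ Hom(R/𝔪, ℤ/p)`** when the residue ring is finite of characteristic `p`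
(`p ∈ 𝔪`) and `ι ≠ 0`: injective (above) between finite sets of the same size (`natCard_addMonoidHom_residue_zmod`).
(Frobenius: the finite field `k` is self-dual over `𝔽_p`.)
[folklore] [cite: Hungerford1974, Ch. IV §4 Exercise 1 (a) (|Hom(G, ℤ/n)| = |G[n]|)] -/
theorem bijective_reading_mulLeft [Finite (R ⧸ IsLocalRing.maximalIdeal R)]
    (hp : (p : R) ∈ IsLocalRing.maximalIdeal R)
    (ι : (R ⧸ IsLocalRing.maximalIdeal R) →+ ZMod p) (hι : ι ≠ 0) :
    Function.Bijective (fun c : R ⧸ IsLocalRing.maximalIdeal R => ι.comp (AddMonoidHom.mulLeft c)) := by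
  haveI : Finite ((R ⧸ IsLocalRing.maximalIdeal R) →+ ZMod p) :=
    Finite.of_injective (fun f : (R ⧸ IsLocalRing.maximalIdeal R) →+ ZMod p => (f : _ → ZMod p))
      DFunLike.coe_injective
  exact (injective_reading_mulLeft ι hι).bijective_of_nat_card_le (le_of_eq (natCard_addMonoidHom_residue_zmod hp))

/-- **A non-zero reading `ι : R/𝔪 →+ ℤ/p` EXISTS** (finite residue ring of characteristic `p`): `|Hom(k, ℤ/p)| = |k| > 1`.
[folklore] [cite: Hungerford1974, Ch. IV §4 Exercise 1 (a)] -/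
theorem exists_reading_ne_zero [Finite (R ⧸ IsLocalRing.maximalIdeal R)]
    (hp : (p : R) ∈ IsLocalRing.maximalIdeal R) :
    ∃ ι : (R ⧸ IsLocalRing.maximalIdeal R) →+ ZMod p, ι ≠ 0 := by
  haveI : Finite ((R ⧸ IsLocalRing.maximalIdeal R) →+ ZMod p) :=
    Finite.of_injective (fun f : (R ⧸ IsLocalRing.maximalIdeal R) →+ ZMod p => (f : _ → ZMod p))
      DFunLike.coe_injective
  haveI : Nontrivial (R ⧸ IsLocalRing.maximalIdeal R) :=
    Ideal.Quotient.nontrivial_iff.mpr (IsLocalRing.maximalIdeal.isMaximal R).ne_top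
  have h1 : 1 < Nat.card ((R ⧸ IsLocalRing.maximalIdeal R) →+ ZMod p) := by
    rw [natCard_addMonoidHom_residue_zmod hp]
    exact Finite.one_lt_card
  haveI : Nontrivial ((R ⧸ IsLocalRing.maximalIdeal R) →+ ZMod p) := (Finite.one_lt_card_iff_nontrivial).mp h1
  exact exists_ne 0

end Reading

/-! ## §2 The `R/𝔪`-valued `R`-bilinear pairing read by `ι` from a balanced `ℤ/p`-valued one -/

section Pairing

variable {R : Type*} [CommRing R] [IsLocalRing R] {p : ℕ} [Fact p.Prime]
  {A B : Type*} [AddCommGroup A] [Module R A] [AddCommGroup B] [Module R B]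

/-- **THE VALUES STEP.** Let `R` be a local ring with finite residue ring `k = R/𝔪` of characteristic `p` and
`ι : k →+ ℤ/p` a non-zero additive functional.  Let `A`, `B` be `R`-modules with `𝔪 B = 0` and `Q : A × B → ℤ/p` a
bi-additive `R`-BALANCED pairing (`Q(ra, b) = Q(a, rb)`).  Then there is an `R`-BILINEAR `P : A →ₗ[R] B →ₗ[R] k` with:
(1) `ι(r̄ P(a,b)) = Q(ra, b)` for all `r` (the reading property); (2) `ι(P(a,b)) = Q(a,b)`; (3)(4) the SAME left and right
kernels as `Q`; (5) every skew identity `Q(a, f a') = -Q(a', f a)` along an `R`-linear `f : A → B` transports to `P`;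
(6) uniqueness: any `R`-bilinear `k`-valued `P'` with `ι ∘ P' = Q` equals `P`.  (Construction: `P(a, b)` is the unique
`c` with `ι(c x) = Q(a, x • b)` for all `x ∈ k`, §1, `B` being a `k`-module.)  This is how a `ℤ/p`-read (or
`ℚ/ℤ`-valued) Cassels–Tate/Flach pairing on `𝔪`-torsion becomes the «nondegenerate pairing of `R/𝔪`-vector spaces»
of Howard's display (i) with the same kernels, for ANY residue degree `[k : 𝔽_p]`.
[folklore] [cite: Howard2004HeegnerKolyvagin, Thm. 1.4.2 proof, display (i) (arXiv:1202.6340 p0008 L116–L128)]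
[cite: Hungerford1974, Ch. IV §4 (duality of finite abelian groups)] -/
theorem exists_bilinear_of_balanced_zmod_pairing [Finite (R ⧸ IsLocalRing.maximalIdeal R)]
    (hp : (p : R) ∈ IsLocalRing.maximalIdeal R)
    (ι : (R ⧸ IsLocalRing.maximalIdeal R) →+ ZMod p) (hι : ι ≠ 0)
    (hB : ∀ m ∈ IsLocalRing.maximalIdeal R, ∀ b : B, m • b = 0)
    (Q : A →+ B →+ ZMod p) (hQ : ∀ (r : R) (a : A) (b : B), Q (r • a) b = Q a (r • b)) :
    ∃ P : A →ₗ[R] B →ₗ[R] (R ⧸ IsLocalRing.maximalIdeal R),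
      (∀ (a : A) (b : B) (r : R),
        ι (Ideal.Quotient.mk (IsLocalRing.maximalIdeal R) r * P a b) = Q (r • a) b) ∧
      (∀ (a : A) (b : B), ι (P a b) = Q a b) ∧
      (∀ a : A, (∀ b, P a b = 0) ↔ ∀ b, Q a b = 0) ∧
      (∀ b : B, (∀ a, P a b = 0) ↔ ∀ a, Q a b = 0) ∧
      (∀ f : A →ₗ[R] B, (∀ a a' : A, Q a (f a') = - Q a' (f a)) → ∀ a a' : A, P a (f a') = - P a' (f a)) ∧
      (∀ P' : A →ₗ[R] B →ₗ[R] (R ⧸ IsLocalRing.maximalIdeal R),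
        (∀ (a : A) (b : B), ι (P' a b) = Q a b) → P' = P) := by
  classical
  -- `B` is a `k`-module (`𝔪B = 0`)
  have hBt : Module.IsTorsionBySet R B (IsLocalRing.maximalIdeal R) := fun b m => hB m.1 m.2 b
  letI : Module (R ⧸ IsLocalRing.maximalIdeal R) B := hBt.module
  have hmk : ∀ (r : R) (b : B), (Ideal.Quotient.mk (IsLocalRing.maximalIdeal R) r) • b = r • b :=
    fun r b => hBt.mk_smul r b
  -- the reading bijection `Φ : c ↦ ι(c ·)`
  have hΦ := bijective_reading_mulLeft hp ι hι
  -- the functional of a pair: `x ↦ Q(a, x • b)`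
  let ψ : A → B → ((R ⧸ IsLocalRing.maximalIdeal R) →+ ZMod p) := fun a b =>
    (Q a).comp ((smulAddHom (R ⧸ IsLocalRing.maximalIdeal R) B).flip b)
  have hψ : ∀ a b (x : R ⧸ IsLocalRing.maximalIdeal R), ψ a b x = Q a (x • b) := fun a b x => by
    show Q a ((smulAddHom (R ⧸ IsLocalRing.maximalIdeal R) B).flip b x) = _
    rw [AddMonoidHom.flip_apply, smulAddHom_apply]
  -- the value `P₀(a, b)`: the unique `c` with `ι(c x) = Q(a, x • b)`
  let P₀ : A → B → R ⧸ IsLocalRing.maximalIdeal R := fun a b => (Equiv.ofBijective _ hΦ).symm (ψ a b)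
  have hP₀ : ∀ a b (x : R ⧸ IsLocalRing.maximalIdeal R), ι (P₀ a b * x) = Q a (x • b) := by
    intro a b x
    have h1 : ι.comp (AddMonoidHom.mulLeft (P₀ a b)) = ψ a b := (Equiv.ofBijective _ hΦ).apply_symm_apply (ψ a b)
    have h2 := DFunLike.congr_fun h1 x
    rw [AddMonoidHom.comp_apply, AddMonoidHom.coe_mulLeft, hψ] at h2
    exact h2
  have huniq : ∀ a b (c : R ⧸ IsLocalRing.maximalIdeal R), (∀ x, ι (c * x) = Q a (x • b)) → c = P₀ a b := by
    intro a b c hc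
    apply hΦ.1
    refine AddMonoidHom.ext fun x => ?_
    show ι (AddMonoidHom.mulLeft c x) = ι (AddMonoidHom.mulLeft (P₀ a b) x)
    rw [AddMonoidHom.coe_mulLeft, AddMonoidHom.coe_mulLeft, hc, hP₀]
  -- bi-additivity and `R`-bilinearity of `P₀`
  have hadd₁ : ∀ a a' b, P₀ (a + a') b = P₀ a b + P₀ a' b := fun a a' b =>
    (huniq (a + a') b _ fun x => by rw [add_mul, map_add, hP₀, hP₀, map_add, AddMonoidHom.add_apply]).symm
  have hadd₂ : ∀ a b b', P₀ a (b + b') = P₀ a b + P₀ a b' := fun a b b' =>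
    (huniq a (b + b') _ fun x => by rw [add_mul, map_add, hP₀, hP₀, smul_add, map_add]).symm
  have hsmul₁ : ∀ (r : R) a b, P₀ (r • a) b = r • P₀ a b := by
    intro r a b
    refine (huniq (r • a) b _ fun x => ?_).symm
    rw [Algebra.smul_def, Ideal.Quotient.algebraMap_eq, mul_comm (Ideal.Quotient.mk _ r) (P₀ a b), mul_assoc, hP₀,
      mul_smul, hmk, hQ]
  have hsmul₂ : ∀ (r : R) a b, P₀ a (r • b) = r • P₀ a b := by
    intro r a b
    refine (huniq a (r • b) _ fun x => ?_).symm
    obtain ⟨s, rfl⟩ := Ideal.Quotient.mk_surjective x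
    rw [Algebra.smul_def, Ideal.Quotient.algebraMap_eq, mul_comm (Ideal.Quotient.mk _ r) (P₀ a b), mul_assoc, hP₀,
      mul_smul, hmk, hmk, hmk, smul_smul, smul_smul, mul_comm]
  let P : A →ₗ[R] B →ₗ[R] (R ⧸ IsLocalRing.maximalIdeal R) := LinearMap.mk₂ R P₀ hadd₁ hsmul₁ hadd₂ hsmul₂
  have hP : ∀ a b, P a b = P₀ a b := fun _ _ => rfl
  -- the reading property
  have hread : ∀ (a : A) (b : B) (r : R),
      ι (Ideal.Quotient.mk (IsLocalRing.maximalIdeal R) r * P a b) = Q (r • a) b := by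
    intro a b r
    rw [hP, mul_comm, hP₀, hmk, hQ]
  have hread₁ : ∀ (a : A) (b : B), ι (P a b) = Q a b := by
    intro a b
    have h1 := hread a b 1
    rwa [map_one, one_mul, one_smul] at h1
  refine ⟨P, hread, hread₁, fun a => ⟨fun h b => ?_, fun h b => ?_⟩, fun b => ⟨fun h a => ?_, fun h a => ?_⟩,
    fun f hf a a' => ?_, fun P' hP' => ?_⟩
  · -- left kernel, `→`
    rw [← hread₁, h b, map_zero]
  · -- left kernel, `←`
    rw [hP]
    refine (huniq a b 0 fun x => ?_).symm
    rw [zero_mul, map_zero, h]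
  · -- right kernel, `→`
    rw [← hread₁, h a, map_zero]
  · -- right kernel, `←`
    rw [hP]
    refine (huniq a b 0 fun x => ?_).symm
    obtain ⟨r, rfl⟩ := Ideal.Quotient.mk_surjective x
    rw [zero_mul, map_zero, hmk, ← hQ, h]
  · -- skew identities transport
    rw [hP, hP]
    refine (huniq a (f a') _ fun x => ?_).symm
    obtain ⟨r, rfl⟩ := Ideal.Quotient.mk_surjective x
    rw [neg_mul, map_neg, hP₀, hmk, hmk, ← LinearMap.map_smul f r a, hf a' (r • a), neg_neg, hQ]
  · -- uniqueness among bilinear pairings read by `ι`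
    refine LinearMap.ext fun a => LinearMap.ext fun b => ?_
    rw [hP]
    refine huniq a b _ fun x => ?_
    obtain ⟨r, rfl⟩ := Ideal.Quotient.mk_surjective x
    have h1 : P' a b * Ideal.Quotient.mk (IsLocalRing.maximalIdeal R) r = P' a (r • b) := by
      rw [LinearMap.map_smul, Algebra.smul_def, Ideal.Quotient.algebraMap_eq, mul_comm]
    rw [h1, hP', hmk]

end Pairing

end Literature.Algebra.Module
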